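import Summits.Ventures.PercRepro.C011
import Summits.Ventures.PercRepro.Support

/-!
# PercRepro — C-011 by the CHOOSE-THE-EDGE induction: only mark-incident edges need concavity
(typer-2, gen 3)

`proofs/LEAD-C011-concavity.md` §8: the induction of `C011_of_PhiPlus_edge_concave` fixes every free
edge in turn; it does not have to.  Per `(G, p)` ONE free edge `g` suffices, chosen incident to a
mark — in the free-edge setting (an edge with `p_e ∈ {0, 1}` is never deleted or contracted, it is
deterministic) this means: one endpoint of `g` is joined to a mark by SURE edges (`p_e = 1`).

* `sureConfig p` (the sure edges open), `G.SureConn p x y` (joined by sure edges), `IsFree p e`,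
  `freeEdges p`;
* **`Concavity5Sure`** — Lemma 5 in free-edge form: `t ↦ Φ⁺(p[g := t])` is concave on `[0, 1]`
  for every FREE edge `g` with an endpoint sure-connected to one of four DISTINCT marks;
* step (0): `phiPlus_eq_zero_of_not_nodup` (coinciding marks: `Φ⁺ = 0`);
* the base of the induction: if no free edge touches the sure-cluster of a mark, the marked
  partition is almost surely the one of the sure configuration (`conn_iff_sureConn_of_support`),
  the law is a point mass (`law4_eq_ite_of_noFreeIncident`) and `Φ⁺ = 0`;
* **`C011_of_Concavity5Sure`** — strong induction on the number of free edges.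
-/

namespace PercRepro

open Finset

variable {V E : Type*} [Fintype E] [DecidableEq E]

/-! ### Sure edges, free edges -/

/-- The configuration with exactly the SURE edges (`p e = 1`) open. -/
noncomputable def sureConfig (p : E → ℝ) : Config E := fun e => decide (p e = 1)

omit [DecidableEq E] in
/-- `sureConfig p` is below every configuration of positive weight. -/
theorem sureConfig_le_of_weight_ne_zero {p : E → ℝ} {ω : Config E} (h : weight p ω ≠ 0) :
    sureConfig p ≤ ω := by
  intro e
  simp only [sureConfig]
  by_cases hpe : p e = 1
  · rw [eq_true_of_weight_ne_zero_of_eq_one h hpe]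
    simp
  · simp [hpe]

/-- `x` and `y` are joined by a path of SURE edges. -/
def MultiGraph.SureConn {V : Type*} (G : MultiGraph V E) (p : E → ℝ) (x y : V) : Prop :=
  G.Conn (sureConfig p) x y

/-- A FREE edge: `0 < p e < 1`. -/
def IsFree (p : E → ℝ) (e : E) : Prop := 0 < p e ∧ p e < 1

open Classical in
/-- The free edges of `p`. -/
noncomputable def freeEdges (p : E → ℝ) : Finset E := Finset.univ.filter (IsFree p)

omit [DecidableEq E] in
open Classical in
/-- Membership in `freeEdges`. -/
theorem mem_freeEdges {p : E → ℝ} {e : E} : e ∈ freeEdges p ↔ IsFree p e := by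
  simp [freeEdges]

omit [Fintype E] [DecidableEq E] in
/-- A deterministic edge (`p e ∈ {0, 1}`) is not free. -/
theorem not_isFree_of_eq_zero {p : E → ℝ} {e : E} (h : p e = 0) : ¬ IsFree p e :=
  fun hf => by simp [IsFree, h] at hf

omit [Fintype E] [DecidableEq E] in
/-- A deterministic edge (`p e ∈ {0, 1}`) is not free. -/
theorem not_isFree_of_eq_one {p : E → ℝ} {e : E} (h : p e = 1) : ¬ IsFree p e :=
  fun hf => by simp [IsFree, h] at hf

/-- Forcing the weight of `g` to `0` or `1` removes exactly `g` from the free edges. -/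
theorem freeEdges_update {p : E → ℝ} {g : E} (hg : IsFree p g) {x : ℝ} (hx : x = 0 ∨ x = 1) :
    freeEdges (Function.update p g x) = (freeEdges p).erase g := by
  classical
  ext e
  simp only [mem_freeEdges, Finset.mem_erase]
  by_cases he : e = g
  · subst he
    simp only [ne_eq, not_true_eq_false, false_and, iff_false]
    rcases hx with rfl | rfl
    · exact not_isFree_of_eq_zero (Function.update_self _ _ _)
    · exact not_isFree_of_eq_one (Function.update_self _ _ _)
  · simp [IsFree, he]

/-- The free edges of `p[g := x]`, `x ∈ {0, 1}`, are fewer than those of `p` when `g` is free. -/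
theorem card_freeEdges_update_lt {p : E → ℝ} {g : E} (hg : IsFree p g) {x : ℝ}
    (hx : x = 0 ∨ x = 1) : (freeEdges (Function.update p g x)).card < (freeEdges p).card := by
  rw [freeEdges_update hg hx]
  exact Finset.card_erase_lt_of_mem (mem_freeEdges.mpr hg)

/-! ### Lemma 5 in free-edge form -/

/-- **Lemma 5, free-edge form** (`LEAD-C011-concavity.md` §8): for every finite multigraph, every
`p ∈ [0,1]^E`, four DISTINCT marks and every FREE edge `g` one of whose endpoints is joined by
SURE edges to one of the marks, `t ↦ Φ⁺(p[g := t])` is concave on `[0, 1]`.  (An edge with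
`p_e ∈ {0, 1}` is a deleted / contracted edge of the minor; "incident to a mark of the minor" is
"incident to the sure-cluster of a mark".) -/
def Concavity5Sure : Prop :=
  ∀ {V E : Type} [Fintype E] [DecidableEq E] (G : MultiGraph V E) (p : E → ℝ), IsProb p →
    ∀ (a b c d : V), [a, b, c, d].Nodup → ∀ g : E, IsFree p g →
      (∃ m, (m = a ∨ m = b ∨ m = c ∨ m = d) ∧
        (G.SureConn p (G.fst g) m ∨ G.SureConn p (G.snd g) m)) →
      ConcaveOn ℝ (Set.Icc (0 : ℝ) 1) fun t => G.PhiPlus (Function.update p g t) a b c d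

/-- Concavity along every edge gives Lemma 5 in free-edge form. -/
theorem Concavity5Sure_of_PhiPlus_edge_concave (h : PhiPlus_edge_concave) : Concavity5Sure :=
  fun G p hp a b c d _ g _ _ => h G p hp a b c d g

namespace MultiGraph

variable {V : Type*} (G : MultiGraph V E)

/-! ### Step (0): coinciding marks -/

omit [Fintype E] [DecidableEq E] in
/-- A partition event whose row separates two coinciding marks is empty. -/
theorem partitionEvent_eq_empty_of_eq {m : Fin 4 → V} {r : Fin 4 → ℕ} {i j : Fin 4}
    (hm : m i = m j) (hr : r i ≠ r j) : G.partitionEvent m r = ∅ := by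
  ext ω
  simp only [Set.mem_empty_iff_false, iff_false]
  intro h
  exact hr ((h i j).mp (hm ▸ Conn.refl G ω (m i)))

/-- **Step (0)**: if two of the four marks coincide, `Φ⁺ = 0` (the rows separating them are empty,
and every product in `Φ⁺` contains one). -/
theorem phiPlus_eq_zero_of_not_nodup (p : E → ℝ) {a b c d : V} (h : ¬ [a, b, c, d].Nodup) :
    G.PhiPlus p a b c d = 0 := by
  have key : ∀ (i j : Fin 4), (![a, b, c, d] : Fin 4 → V) i = ![a, b, c, d] j → ∀ s : Fin 15,
      rgs4 s i ≠ rgs4 s j → G.law4 p a b c d s = 0 := by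
    intro i j hij s hs
    rw [law4, G.partitionEvent_eq_empty_of_eq hij hs, prob_empty]
  simp only [PhiPlus, liabilitySum_eq]
  -- which pair coincides
  by_cases hab : a = b
  · have h1 := key 0 1 (by simp [hab])
    simp only [rgs4] at h1
    have e14 := h1 14 (by decide); have e6 := h1 6 (by decide); have e8 := h1 8 (by decide)
    have e7 := h1 7 (by decide); have e12 := h1 12 (by decide)
    have e11 := h1 11 (by decide); have e10 := h1 10 (by decide)
    rw [e14, e6, e8, e7, e12, e11, e10]; ring
  by_cases hac : a = c
  · have h1 := key 0 2 (by simp [hac])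
    simp only [rgs4] at h1
    have e14 := h1 14 (by decide); have e3 := h1 3 (by decide); have e8 := h1 8 (by decide)
    have e4 := h1 4 (by decide); have e13 := h1 13 (by decide)
    have e11 := h1 11 (by decide); have e10 := h1 10 (by decide)
    rw [e14, e3, e8, e4, e13, e11, e10]; ring
  by_cases had : a = d
  · have h1 := key 0 3 (by simp [had])
    simp only [rgs4] at h1
    have e14 := h1 14 (by decide); have e3 := h1 3 (by decide); have e6 := h1 6 (by decide)
    have e4 := h1 4 (by decide); have e13 := h1 13 (by decide)
    have e7 := h1 7 (by decide); have e12 := h1 12 (by decide)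
    rw [e14, e3, e6, e4, e13, e7, e12]; ring
  by_cases hbc : b = c
  · have h1 := key 1 2 (by simp [hbc])
    simp only [rgs4] at h1
    have e14 := h1 14 (by decide); have e3 := h1 3 (by decide); have e6 := h1 6 (by decide)
    have e4 := h1 4 (by decide); have e13 := h1 13 (by decide)
    have e7 := h1 7 (by decide); have e12 := h1 12 (by decide)
    rw [e14, e3, e6, e4, e13, e7, e12]; ring
  by_cases hbd : b = d
  · have h1 := key 1 3 (by simp [hbd])
    simp only [rgs4] at h1
    have e14 := h1 14 (by decide); have e3 := h1 3 (by decide); have e8 := h1 8 (by decide)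
    have e4 := h1 4 (by decide); have e13 := h1 13 (by decide)
    have e11 := h1 11 (by decide); have e10 := h1 10 (by decide)
    rw [e14, e3, e8, e4, e13, e11, e10]; ring
  by_cases hcd : c = d
  · have h1 := key 2 3 (by simp [hcd])
    simp only [rgs4] at h1
    have e14 := h1 14 (by decide); have e6 := h1 6 (by decide); have e8 := h1 8 (by decide)
    have e7 := h1 7 (by decide); have e12 := h1 12 (by decide)
    have e11 := h1 11 (by decide); have e10 := h1 10 (by decide)
    rw [e14, e6, e8, e7, e12, e11, e10]; ring
  exact absurd (by simp [hab, hac, had, hbc, hbd, hcd]) h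

/-! ### The base of the induction: no free edge touches the sure-cluster of a mark -/

omit [Fintype E] [DecidableEq E] in
/-- A non-free edge of a probability vector is deterministic. -/
theorem eq_zero_or_eq_one_of_not_isFree {p : E → ℝ} (hp : IsProb p) {e : E} (h : ¬ IsFree p e) :
    p e = 0 ∨ p e = 1 := by
  rcases lt_or_eq_of_le (hp.nonneg e) with h0 | h0
  · rcases lt_or_eq_of_le (hp.le_one e) with h1 | h1
    · exact absurd ⟨h0, h1⟩ h
    · exact Or.inr h1
  · exact Or.inl h0.symm

omit [DecidableEq E] in
/-- **On the support, connectivity from a mark is sure-connectivity** when no free edge has an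
endpoint in the sure-cluster of a mark: the sure-cluster of `m` has closed boundary in every
configuration of positive weight. -/
theorem conn_iff_sureConn_of_support {p : E → ℝ} (hp : IsProb p) {a b c d : V}
    (hno : ∀ g, IsFree p g → ∀ m, (m = a ∨ m = b ∨ m = c ∨ m = d) →
      ¬ G.SureConn p (G.fst g) m ∧ ¬ G.SureConn p (G.snd g) m)
    {ω : Config E} (hw : weight p ω ≠ 0) {m : V} (hm : m = a ∨ m = b ∨ m = c ∨ m = d) (y : V) :
    G.Conn ω m y ↔ G.SureConn p m y := by
  constructor
  · intro h
    refine G.mem_of_conn_of_closed_boundary (X := {z | G.SureConn p m z}) ?_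
      (show m ∈ {z | G.SureConn p m z} from Conn.refl G _ m) h
    intro e he
    simp only [Set.mem_setOf_eq]
    by_cases hf : IsFree p e
    · obtain ⟨h1, h2⟩ := hno e hf m hm
      exact ⟨fun hx => absurd hx.symm h1, fun hx => absurd hx.symm h2⟩
    · rcases eq_zero_or_eq_one_of_not_isFree hp hf with h0 | h1
      · exact absurd he (by rw [eq_false_of_weight_ne_zero_of_eq_zero hw h0]; simp)
      · have hadj : G.Conn (sureConfig p) (G.fst e) (G.snd e) :=
          Conn.of_openAdj ⟨e, by simp [sureConfig, h1], Or.inl ⟨rfl, rfl⟩⟩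
        exact ⟨fun hx => (show G.Conn _ m _ from hx).trans hadj,
          fun hx => (show G.Conn _ m _ from hx).trans hadj.symm⟩
  · intro h
    exact (show G.Conn (sureConfig p) m y from h).mono (sureConfig_le_of_weight_ne_zero hw)

omit [DecidableEq E] in
/-- Under the same hypothesis every configuration of the support has the marked partition of the
sure configuration. -/
theorem mem_partitionEvent_iff_sure_of_support {p : E → ℝ} (hp : IsProb p) {a b c d : V}
    (hno : ∀ g, IsFree p g → ∀ m, (m = a ∨ m = b ∨ m = c ∨ m = d) →
      ¬ G.SureConn p (G.fst g) m ∧ ¬ G.SureConn p (G.snd g) m)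
    {ω : Config E} (hw : weight p ω ≠ 0) (r : Fin 4 → ℕ) :
    ω ∈ G.partitionEvent ![a, b, c, d] r ↔ sureConfig p ∈ G.partitionEvent ![a, b, c, d] r := by
  rw [G.mem_partitionEvent_four_pairs, G.mem_partitionEvent_four_pairs]
  refine forall_congr' fun i => ?_
  have hm : (![a, b, c, d] : Fin 4 → V) (pair4 i).1 = a ∨ (![a, b, c, d] : Fin 4 → V) (pair4 i).1 = b ∨
      (![a, b, c, d] : Fin 4 → V) (pair4 i).1 = c ∨ (![a, b, c, d] : Fin 4 → V) (pair4 i).1 = d := by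
    fin_cases i <;> simp [pair4]
  rw [G.conn_iff_sureConn_of_support hp hno hw hm]
  rfl

/-- The law is a point mass on the row of the sure configuration. -/
theorem law4_eq_ite_of_noFreeIncident {p : E → ℝ} (hp : IsProb p) {a b c d : V}
    (hno : ∀ g, IsFree p g → ∀ m, (m = a ∨ m = b ∨ m = c ∨ m = d) →
      ¬ G.SureConn p (G.fst g) m ∧ ¬ G.SureConn p (G.snd g) m) (s : Fin 15) :
    G.law4 p a b c d s =
      if row4 (G.markedPartition (sureConfig p) ![a, b, c, d]) = s then 1 else 0 := by
  by_cases hs : sureConfig p ∈ G.partitionEvent ![a, b, c, d] (rgs4 s)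
  · rw [law4, if_pos ((G.row4_markedPartition_eq_iff _ _).mpr hs)]
    exact prob_eq_one_of_forall_mem p fun ω hw =>
      (G.mem_partitionEvent_iff_sure_of_support hp hno hw _).mpr hs
  · rw [law4, if_neg (fun h => hs ((G.row4_markedPartition_eq_iff _ _).mp h))]
    refine prob_eq_zero_of_forall_weight_eq_zero p fun ω hω => ?_
    by_contra hw
    exact hs ((G.mem_partitionEvent_iff_sure_of_support hp hno hw _).mp hω)

/-- `Φ⁺` vanishes when the law is a point mass. -/
theorem phiPlus_eq_zero_of_law4_eq_ite (p : E → ℝ) (a b c d : V) (t : Fin 15)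
    (h : ∀ s, G.law4 p a b c d s = if t = s then 1 else 0) : G.PhiPlus p a b c d = 0 := by
  simp only [PhiPlus, liabilitySum_eq, h]
  fin_cases t <;> simp [Fin.ext_iff]

/-- **The base of the choose-the-edge induction**: if no free edge has an endpoint in the
sure-cluster of a mark, `Φ⁺ = 0`. -/
theorem phiPlus_eq_zero_of_noFreeIncident {p : E → ℝ} (hp : IsProb p) {a b c d : V}
    (hno : ∀ g, IsFree p g → ∀ m, (m = a ∨ m = b ∨ m = c ∨ m = d) →
      ¬ G.SureConn p (G.fst g) m ∧ ¬ G.SureConn p (G.snd g) m) :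
    G.PhiPlus p a b c d = 0 :=
  G.phiPlus_eq_zero_of_law4_eq_ite p a b c d _ (G.law4_eq_ite_of_noFreeIncident hp hno)

end MultiGraph

/-- **C-005⁺ from Lemma 5 in free-edge form** (`LEAD-C011-concavity.md` §8, steps (0)–(3)): strong
induction on the number of free edges; coinciding marks give `Φ⁺ = 0`; if some free edge has an
endpoint sure-connected to a mark, concavity along it and the induction hypothesis for the two
deterministic specialisations; otherwise the marked partition is almost surely constant and
`Φ⁺ = 0`. -/
theorem C011_of_Concavity5Sure (h5 : Concavity5Sure) : C011 := by
  rw [C011_iff_phiPlus_nonneg]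
  intro V E _ _ G p hp a b c d
  by_cases hn : [a, b, c, d].Nodup
  swap
  · rw [G.phiPlus_eq_zero_of_not_nodup p hn]
  suffices key : ∀ n : ℕ, ∀ q : E → ℝ, IsProb q → (freeEdges q).card = n →
      0 ≤ G.PhiPlus q a b c d from key _ p hp rfl
  intro n
  induction n using Nat.strong_induction_on with
  | _ n ih =>
    intro q hq hcard
    by_cases hex : ∃ g, IsFree q g ∧ ∃ m, (m = a ∨ m = b ∨ m = c ∨ m = d) ∧
        (G.SureConn q (G.fst g) m ∨ G.SureConn q (G.snd g) m)
    · obtain ⟨g, hg, hm⟩ := hex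
      have hc := h5 G q hq a b c d hn g hg hm
      have h0 : 0 ≤ G.PhiPlus (Function.update q g 0) a b c d :=
        ih _ (by rw [← hcard]; exact card_freeEdges_update_lt hg (Or.inl rfl)) _
          (hq.update g ⟨le_rfl, zero_le_one⟩) rfl
      have h1 : 0 ≤ G.PhiPlus (Function.update q g 1) a b c d :=
        ih _ (by rw [← hcard]; exact card_freeEdges_update_lt hg (Or.inr rfl)) _
          (hq.update g ⟨zero_le_one, le_rfl⟩) rfl
      have hg0 : (0 : ℝ) ≤ q g := hq.nonneg g
      have hg1 : q g ≤ 1 := hq.le_one g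
      have key := hc.2 (Set.left_mem_Icc.mpr zero_le_one) (Set.right_mem_Icc.mpr zero_le_one)
        (sub_nonneg.mpr hg1) hg0 (by ring)
      simp only [smul_eq_mul, mul_zero, zero_add, mul_one] at key
      rw [Function.update_eq_self g q] at key
      nlinarith [mul_nonneg (sub_nonneg.mpr hg1) h0, mul_nonneg hg0 h1]
    · push Not at hex
      rw [G.phiPlus_eq_zero_of_noFreeIncident hq hex]

end PercRepro
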